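import Literature.Computability.Complexity.TVFunction
import Literature.Computability.Complexity.GF2StringArith
import HarnessLib

/-!
# The string model of evaluating Trevisan–Vadhan's `F`: the universal matrix and the downward step
# on the bit strings of `GF(2^{M+1})` (towards the oracle machine of TV07 Thm. 4.3 / Lemma 4.1 (i))

Literature / complexity — derandomization (Case 2 of IW98 in TV07 form), sequel of `TVFunction.lean`
(`Fni_mlen`: the last stage is a bit of the universal MATRIX `matrixPoly` at the point; `Fni_eq_of_queries`:
every other stage is a bit of `opValue` applied to two reassembled field values) and of
`GF2StringArith.lean` (field elements of `GF2 M` as `M+1`-bit strings `GF2Str.bits`, with `xorStr_bits`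
(addition) and `fmulStr_bits` (multiplication)). In the style of `GF2StringArith.lean` §Ext (string
models `deltaStr`, `termStr`, `extStr` that the `FP` bricks of `HardLangMachine.lean` are identified with),
this file writes the two computations the oracle machine performs as plain string functions — folds
of `fmulStr`/`xorStr` over `List.range` — and proves their values:

* `QBFUniv.eval_matrixPoly` — the closed form `Π_j (1 − Π_k (1 − y_{jk} x_k)(1 − z_{jk}(1 − x_k)))` of the
  matrix at a point (any commutative ring);
* `QBFUniv.oneStr`, `QBFUniv.litFactorStr`, `QBFUniv.prodStr`, `QBFUniv.clauseStr`, `QBFUniv.matrixStr`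
  with `litFactorStr_bits`, `prodStr_bits`, `clauseStr_bits`, **`matrixStr_bits`**: on the bits of the
  coordinates of a point, `matrixStr` spells the bits of the matrix value (characteristic `2`: `1 − a = 1 + a`);
* `QBFUniv.opQuantStr`, `QBFUniv.opLinStr` with `opQuantStr_bits`, `opLinStr_bits` — the string forms of
  `opValue` (the selected quantifier step and the linearization from two field values);
* the wrap-up `matrixStr_eq_bits_eval` / `opStr`, `opStr_bits` in the vocabulary of `TVFunction.lean`
  (`K n = GF2 (Mof n)`, `UOp`, `opValue`).

Everything is proved; definitions are plain (no named facts). The `FP` bricks realizing these folds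
(`foldLoop fmulOpF …` with the modulus from `modSearchF`) are the next, machine, file.

## References

* [TrevisanVadhan2007] L. Trevisan, S. Vadhan, Comput. Complexity 16 (2007), Lemma 4.1 (i)
  ("`f_{n,m(n)}` can be evaluated in time poly(n)"; "`f_{n,i}` can be computed in time poly(n) given oracle
  access to `f_{n,i+1}`") and Thm. 4.3 (held text pp. 12–13).
* R. J. McEliece, *The Theory of Information and Coding*, 2nd ed., CUP 2002, Ch. 9 §9.1 (field elements
  as coefficient tuples) [Mceliece2002] — cited through `GF2StringArith.lean`.
-/

noncomputable section

namespace Literature.Computability.Complexity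

namespace QBFUniv

open MvPolynomial Finset GF2Str Literature.InformationTheory.Coding

/-! ### The closed form of the matrix -/

/-- **The universal matrix at a point**, in closed form. [cite: TrevisanVadhan2007, §4 (4.1)] -/
theorem eval_matrixPoly {R : Type*} [CommRing R] (n : ℕ) (x : Fin (N n) → R) :
    eval x (matrixPoly R n) =
      ∏ j : Fin n, (1 - ∏ k : Fin n, (1 - x (lay n (.y j k)) * x (lay n (.x k))) *
        (1 - x (lay n (.z j k)) * (1 - x (lay n (.x k))))) := by
  simp [matrixPoly, clausePoly, litFactor, map_prod, V]

/-! ### String models over `GF(2^{M+1})` -/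

section Str

variable (M : ℕ)

/-- The bits of `1`. [folklore] -/
def oneStr : List Bool := bits M 1

/-- **The literal factor on strings**: `(1 + y·x)(1 + z(1 + x))` (characteristic `2`). [cite: TrevisanVadhan2007, Lemma 4.1 (i)] -/
def litFactorStr (y x z : List Bool) : List Bool :=
  fmulStr M (xorStr (oneStr M) (fmulStr M y x)) (xorStr (oneStr M) (fmulStr M z (xorStr (oneStr M) x)))

/-- Value of the literal factor on bits. [folklore] -/
theorem litFactorStr_bits (Y X Z : GF2 M) :
    litFactorStr M (bits M Y) (bits M X) (bits M Z) = bits M ((1 - Y * X) * (1 - Z * (1 - X))) := by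
  simp only [litFactorStr, oneStr, fmulStr_bits, xorStr_bits, sub_eq_add']

/-- **A product fold on strings**: `Π_{k < n} g k`, accumulated from `1` by `fmulStr`. [folklore] -/
def prodStr (g : ℕ → List Bool) (n : ℕ) : List Bool :=
  (List.range n).foldl (fun acc k => fmulStr M acc (g k)) (oneStr M)

/-- Value of the product fold on bits. [folklore] -/
theorem prodStr_bits (G : ℕ → GF2 M) (n : ℕ) : prodStr M (fun k => bits M (G k)) n = bits M (∏ k ∈ range n, G k) := by
  induction n with
  | zero => simp [prodStr, oneStr]
  | succ n ih =>
    rw [prodStr, List.range_succ, List.foldl_append, List.foldl_cons, List.foldl_nil, ← prodStr, ih, fmulStr_bits,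
      prod_range_succ]

/-- The product fold only reads `g` below `n`. [folklore] -/
theorem prodStr_congr {g g' : ℕ → List Bool} {n : ℕ} (h : ∀ k < n, g k = g' k) : prodStr M g n = prodStr M g' n := by
  rw [prodStr, prodStr]
  exact List.foldl_ext _ _ _ fun acc k hk => by rw [h k (List.mem_range.1 hk)]

/-- **The clause on strings**: `1 + Π_k litFactorStr`. [cite: TrevisanVadhan2007, Lemma 4.1 (i)] -/
def clauseStr (ys xs zs : ℕ → List Bool) (n : ℕ) : List Bool :=
  xorStr (oneStr M) (prodStr M (fun k => litFactorStr M (ys k) (xs k) (zs k)) n)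

/-- Value of the clause on bits. [folklore] -/
theorem clauseStr_bits (Y X Z : ℕ → GF2 M) (n : ℕ) :
    clauseStr M (fun k => bits M (Y k)) (fun k => bits M (X k)) (fun k => bits M (Z k)) n =
      bits M (1 - ∏ k ∈ range n, (1 - Y k * X k) * (1 - Z k * (1 - X k))) := by
  rw [clauseStr, oneStr]
  rw [prodStr_congr M (g' := fun k => bits M ((1 - Y k * X k) * (1 - Z k * (1 - X k)))) fun k _ => litFactorStr_bits M _ _ _,
    prodStr_bits, xorStr_bits, sub_eq_add']

/-- **The matrix on strings**: `Π_j clauseStr j`. [cite: TrevisanVadhan2007, Lemma 4.1 (i)] -/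
def matrixStr (ys zs : ℕ → ℕ → List Bool) (xs : ℕ → List Bool) (n : ℕ) : List Bool :=
  prodStr M (fun j => clauseStr M (ys j) xs (zs j) n) n

/-- **Value of the matrix on bits.** [cite: TrevisanVadhan2007, Lemma 4.1 (i)] -/
theorem matrixStr_bits (Y Z : ℕ → ℕ → GF2 M) (X : ℕ → GF2 M) (n : ℕ) :
    matrixStr M (fun j k => bits M (Y j k)) (fun j k => bits M (Z j k)) (fun k => bits M (X k)) n =
      bits M (∏ j ∈ range n, (1 - ∏ k ∈ range n, (1 - Y j k * X k) * (1 - Z j k * (1 - X k)))) := by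
  rw [matrixStr, prodStr_congr M (g' := fun j => bits M (1 - ∏ k ∈ range n, (1 - Y j k * X k) * (1 - Z j k * (1 - X k))))
    fun j _ => clauseStr_bits M _ _ _ _, prodStr_bits]

/-- **The selected quantifier step on strings**: `s·(V₀V₁) + (1+s)(1 + (1+V₀)(1+V₁))`.
[cite: TrevisanVadhan2007, Lemma 4.1 (i)] -/
def opQuantStr (s V0 V1 : List Bool) : List Bool :=
  xorStr (fmulStr M s (fmulStr M V0 V1))
    (fmulStr M (xorStr (oneStr M) s) (xorStr (oneStr M) (fmulStr M (xorStr (oneStr M) V0) (xorStr (oneStr M) V1))))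

/-- Value of the quantifier step on bits. [folklore] -/
theorem opQuantStr_bits (S v0 v1 : GF2 M) :
    opQuantStr M (bits M S) (bits M v0) (bits M v1) = bits M (S * (v0 * v1) + (1 - S) * (1 - (1 - v0) * (1 - v1))) := by
  simp only [opQuantStr, oneStr, fmulStr_bits, xorStr_bits, sub_eq_add']

/-- **The linearization step on strings**: `(1+ξ)V₀ + ξV₁`. [cite: TrevisanVadhan2007, Lemma 4.1 (i)] -/
def opLinStr (xi V0 V1 : List Bool) : List Bool :=
  xorStr (fmulStr M (xorStr (oneStr M) xi) V0) (fmulStr M xi V1)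

/-- Value of the linearization step on bits. [folklore] -/
theorem opLinStr_bits (ξ v0 v1 : GF2 M) :
    opLinStr M (bits M ξ) (bits M v0) (bits M v1) = bits M ((1 - ξ) * v0 + ξ * v1) := by
  simp only [opLinStr, oneStr, fmulStr_bits, xorStr_bits, sub_eq_add']

end Str

/-! ### In the vocabulary of `TVFunction.lean` -/

/-- Products over `Fin n` as products over `range n`. [folklore] -/
private theorem prod_fin_eq_prod_range' {β : Type*} [CommMonoid β] (n : ℕ) (g : ℕ → β) :
    ∏ k : Fin n, g k.val = ∏ k ∈ range n, g k := (Fin.prod_univ_eq_prod_range g n)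

/-- Coordinates of a point read through `ℕ`-indices (junk `0` out of range). [folklore] -/
def coordY (n : ℕ) (x : Fin (N n) → K n) (j k : ℕ) : K n :=
  if h : j < n ∧ k < n then x (lay n (.y ⟨j, h.1⟩ ⟨k, h.2⟩)) else 0

/-- Coordinates of a point read through `ℕ`-indices (junk `0` out of range). [folklore] -/
def coordZ (n : ℕ) (x : Fin (N n) → K n) (j k : ℕ) : K n :=
  if h : j < n ∧ k < n then x (lay n (.z ⟨j, h.1⟩ ⟨k, h.2⟩)) else 0

/-- Coordinates of a point read through `ℕ`-indices (junk `0` out of range). [folklore] -/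
def coordX (n : ℕ) (x : Fin (N n) → K n) (k : ℕ) : K n :=
  if h : k < n then x (lay n (.x ⟨k, h⟩)) else 0

/-- **The matrix string model computes the bits of `f_{n,m(n)}` at the point.**
[cite: TrevisanVadhan2007, Lemma 4.1 (i)] -/
theorem matrixStr_eq_bits_eval (n : ℕ) (x : Fin (N n) → K n) :
    matrixStr (Mof n) (fun j k => bits (Mof n) (coordY n x j k)) (fun j k => bits (Mof n) (coordZ n x j k))
      (fun k => bits (Mof n) (coordX n x k)) n = bits (Mof n) (eval x (matrixPoly (K n) n)) := by
  rw [matrixStr_bits, eval_matrixPoly]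
  congr 1
  rw [← prod_fin_eq_prod_range' n]
  refine prod_congr rfl fun j _ => ?_
  congr 1
  rw [← prod_fin_eq_prod_range' n]
  refine prod_congr rfl fun k _ => ?_
  simp [coordY, coordZ, coordX, j.isLt, k.isLt]

/-- **The string form of one operator of the fine schedule**: the quantifier step reads the selector's
bits, the linearization the coordinate's bits. [cite: TrevisanVadhan2007, Lemma 4.1 (i)] -/
def opStr (n : ℕ) (o : UOp n) (sbits : Fin n → List Bool) (xbits : Fin (N n) → List Bool) (V0 V1 : List Bool) :
    List Bool :=
  match o with
  | .quant k => opQuantStr (Mof n) (sbits k) V0 V1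
  | .lin i => opLinStr (Mof n) (xbits i) V0 V1

/-- **The string form of an operator computes the bits of `opValue`.** [cite: TrevisanVadhan2007, Lemma 4.1 (i)] -/
theorem opStr_bits {n : ℕ} (o : UOp n) (x : Fin (N n) → K n) (v0 v1 : K n) :
    opStr n o (fun k => bits (Mof n) (x (lay n (.s k)))) (fun i => bits (Mof n) (x i)) (bits (Mof n) v0) (bits (Mof n) v1) =
      bits (Mof n) (opValue o x v0 v1) := by
  cases o with
  | quant k => exact opQuantStr_bits (Mof n) _ v0 v1
  | lin i => exact opLinStr_bits (Mof n) _ v0 v1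

end QBFUniv

end Literature.Computability.Complexity

end
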